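import Literature.NumberTheory.LFunctions.WeilTwoPrimeCertificate
import HarnessLib

/-!
# Soundness of the odd-sector margin certificate (two-prime format)

Topic: `Literature/NumberTheory/LFunctions`. The two-prime certificate format `WeilCert23`
(`WeilTwoPrimeCertificate.lean`) proves `E₂₃(g) ≥ 0` on `C(b)` through the analytic reduction
`WeilCert23.margin_step3` (`Σ P_r z + κ ‖g‖₂² ≤ E₂₃(g)`, valid for every test function), Bessel,
and the algebraic core `Σ P_r z + κ · Bessel = Σ_p Re y_p* S'_p y_p ≥ 0` over the two parity blocks
`p = 0, 1`. For an ODD test function the even moments `M_{2i} = ∫ g (x/a₀)^{2i}` vanish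
(`weilMoment_even_of_odd`), so only the odd block is needed (`WeilCert.core_nonnegK_odd`), and
running the Bessel step with a smaller coefficient `κ' ≤ κ` leaves the MARGIN
`(κ − κ') ‖g‖₂² ≤ E₂₃(g)` (**`WeilCert23.weilTwoPrimeQuadratic_margin_of_parts`**): a certified
lower bound for the odd-sector bottom of `Re Q` on the window `[-b, b]`.
Everything here is proved; no named facts.

## References

* H. Yoshida, *On Hermitian forms attached to zeta functions*, Adv. Stud. Pure Math. 21 (1992),
  §2 (2.1), §6, Theorem 1 (p. 310). [Yoshida1992]
-/

noncomputable section

open Complex Finset MeasureTheory Set Filter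
open scoped Real Topology ComplexConjugate BigOperators

namespace Literature.NumberTheory.LFunctions

open Literature.Analysis.ValidatedNumerics.Numerics
open Literature.Analysis.SpecialFunctions

/-- Odd functions have vanishing even moments: `∫ g(x) (x/a)^q dx = 0` for even `q` if
`g(−x) = −g(x)`. [folklore] -/
theorem weilMoment_even_of_odd {g : ℝ → ℂ} (hodd : ∀ x, g (-x) = -g x) (a : ℝ) {q : ℕ}
    (hq : Even q) : weilMoment a g q = 0 := by
  have h := integral_neg_eq_self (fun x : ℝ ↦ g x * ((((x / a) ^ q : ℝ)) : ℂ)) volume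
  have h2 : ∀ x : ℝ, g (-x) * ((((-x / a) ^ q : ℝ)) : ℂ) =
      -(g x * ((((x / a) ^ q : ℝ)) : ℂ)) := fun x ↦ by
    rw [hodd, neg_div, hq.neg_pow, neg_mul]
  simp only [h2, integral_neg] at h
  unfold weilMoment
  linear_combination (-(1 : ℂ) / 2) * h

/-- **The algebraic core on the odd block.** If the even entries of `M` vanish, then with
`N + 1 = 2 nb` and only the ODD block checked (`checkBlockK nu κ 1`), the reduced form plus `κ ×`
the Bessel expression is `Re y₁* S'₁ y₁ ≥ 0` (the even block contributes nothing: `y₀ = 0`,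
`u(2i) = 0`); odd-sector companion of `WeilCert.core_nonnegK` (Gram matrix at `a = a₀`). [folklore] -/
theorem WeilCert.core_nonnegK_odd {c : WeilCert} {nu : List ℚ} {κ : ℚ} (hN : c.N + 1 = 2 * c.nb)
    (hb1 : c.checkBlockK nu κ 1 = true) (M : ℕ → ℂ) (hM : ∀ i, M (2 * i) = 0) :
    0 ≤ (∑ k ∈ range (c.N + 1), ∑ l ∈ range (c.N + 1),
        (c.prQ nu k l : ℝ) * (conj (M k) * M l).re) +
      (κ : ℝ) *
        (2 * (∑ k ∈ range (c.N + 1), conj (c.uVec M k) * M k).re -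
          (∑ k ∈ range (c.N + 1), ∑ l ∈ range (c.N + 1),
            conj (c.uVec M k) * c.uVec M l * (gramH (c.a0 : ℝ) k l : ℂ)).re) := by
  set a : ℝ := (c.a0 : ℝ) with ha_def
  have hDC1 : c.checkDC 1 = true := by
    unfold WeilCert.checkBlockK at hb1; rw [Bool.and_eq_true] at hb1; exact hb1.1
  -- the even coordinates vanish
  have hy0 : ∀ j, c.yVec M 0 j = 0 := fun j ↦ by
    unfold WeilCert.yVec
    exact Finset.sum_eq_zero fun i _ ↦ by rw [add_zero, hM, mul_zero]
  have hu0 : ∀ i, c.uVec M (2 * i) = 0 := fun i ↦ by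
    have h := WeilCert.uVec_block (c := c) M 0 i (by norm_num)
    rw [add_zero] at h
    rw [h]
    exact Finset.sum_eq_zero fun j _ ↦ by rw [hy0, mul_zero]
  -- rewrite everything as the real part of one complex expression
  have key : (∑ k ∈ range (c.N + 1), ∑ l ∈ range (c.N + 1),
        (c.prQ nu k l : ℝ) * (conj (M k) * M l).re) +
      (κ : ℝ) *
        (2 * (∑ k ∈ range (c.N + 1), conj (c.uVec M k) * M k).re -
          (∑ k ∈ range (c.N + 1), ∑ l ∈ range (c.N + 1),
            conj (c.uVec M k) * c.uVec M l * (gramH a k l : ℂ)).re) =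
      ((∑ k ∈ range (c.N + 1), ∑ l ∈ range (c.N + 1),
          (c.prQ nu k l : ℂ) * (conj (M k) * M l)) +
        (κ : ℂ) *
          (2 * ∑ k ∈ range (c.N + 1), conj (c.uVec M k) * M k -
            ∑ k ∈ range (c.N + 1), ∑ l ∈ range (c.N + 1),
              conj (c.uVec M k) * c.uVec M l * (gramH a k l : ℂ))).re := by
    have e1 : (∑ k ∈ range (c.N + 1), ∑ l ∈ range (c.N + 1),
        (c.prQ nu k l : ℂ) * (conj (M k) * M l)).re =
        ∑ k ∈ range (c.N + 1), ∑ l ∈ range (c.N + 1), (c.prQ nu k l : ℝ) * (conj (M k) * M l).re := by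
      rw [Complex.re_sum]
      refine Finset.sum_congr rfl fun k _ ↦ ?_
      rw [Complex.re_sum]
      refine Finset.sum_congr rfl fun l _ ↦ ?_
      rw [show ((c.prQ nu k l : ℚ) : ℂ) = (((c.prQ nu k l : ℚ) : ℝ) : ℂ) by norm_cast,
        Complex.re_ofReal_mul]
    have e2 : ∀ (κ : ℚ) (X Y : ℂ), ((κ : ℂ) * (2 * X - Y)).re = (κ : ℝ) * (2 * X.re - Y.re) := by
      intro κ X Y
      rw [show ((κ : ℚ) : ℂ) = (((κ : ℚ) : ℝ) : ℂ) by norm_cast, Complex.re_ofReal_mul]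
      congr 1
      simp [Complex.mul_re]
    rw [Complex.add_re, e1, e2]
  rw [key]
  -- parity split
  have hH : ∀ k l, k % 2 ≠ l % 2 → (gramH a k l : ℂ) = 0 := by
    intro k l hkl
    have hodd : Odd (k + l) := by
      rcases Nat.even_or_odd k with hk | hk <;> rcases Nat.even_or_odd l with hl | hl
      · exact absurd (by rw [Nat.even_iff.1 hk, Nat.even_iff.1 hl]) hkl
      · exact hk.add_odd hl
      · exact hk.add_even hl
      · exact absurd (by rw [Nat.odd_iff.1 hk, Nat.odd_iff.1 hl]) hkl
    rw [gramH, hodd.neg_one_pow]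
    simp
  rw [hN, WeilAlg.sum_sum_range_two_mul c.nb _ (fun k l hkl ↦ by
      rw [WeilCert.prQ_cross nu hkl]; simp),
    WeilAlg.sum_range_two_mul c.nb,
    WeilAlg.sum_sum_range_two_mul c.nb _ (fun k l hkl ↦ by rw [hH k l hkl]; simp)]
  -- the Gram entries on the odd block
  have hG1 : ∀ i i', (gramH a (2 * i + 1) (2 * i' + 1) : ℂ) = (c.hBlkQ 1 i i' : ℂ) := by
    intro i i'
    have hev : Even (2 * i + 1 + (2 * i' + 1)) := ⟨i + i' + 1, by ring⟩
    rw [gramH, hev.neg_one_pow, WeilCert.hBlkQ, ha_def]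
    push_cast
    ring
  simp_rw [hG1]
  have e1 := WeilCert.block_identityK (c := c) (nu := nu) κ (p := 1) (by norm_num) hDC1 M
  -- the even block vanishes
  simp only [hM, hu0, map_zero, zero_mul, mul_zero, Finset.sum_const_zero, zero_add]
  rw [e1]
  exact WeilAlg.re_herm_nonneg c.nb _ (fun x ↦ WeilCert.spFunK_quad_nonneg hb1 x) _

/-- **Soundness of the odd-sector margin certificate (two-prime format).** If a certificate `c`
passes the cells, scalar and moment checks and its ODD block passes `checkBlockK` with a Bessel
coefficient `κ'`, `0 ≤ κ' ≤ κ(c)`, then every ODD test function `g` on `[-b, b]` has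
`(κ(c) − κ') ‖g‖₂² ≤ E₂₃(g)` (`E₂₃ = weilTwoPrimeQuadratic`): for odd `g` the even moments
`M_{2i}` vanish, so only the odd block enters the algebraic core; `WeilCert23.margin_step3` gives
`Σ P_r z + κ ‖g‖₂² ≤ E₂₃(g)`, Bessel is applied with the coefficient `κ' ≥ 0`, and the difference
`(κ − κ') ‖g‖₂²` is the margin. [folklore] -/
theorem WeilCert23.weilTwoPrimeQuadratic_margin_of_parts (c : WeilCert23) (κ' : ℚ)
    (hcells : checkCells₂₃ c.base.prec c.j c.base.wL c.base.T c.base.mwT c.cells = true)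
    (hsc : c.checkScalars = true) (hnu : c.checkNu = true)
    (hblk : c.base.checkBlockK c.nuTab κ' 1 = true) (hκ'0 : 0 ≤ κ') (hκ'le : κ' ≤ c.kappaQ)
    {g : ℝ → ℂ} (hg : IsWeilTest g) (hsupp : tsupport g ⊆ Icc (-(c.b : ℝ)) c.b)
    (hodd : ∀ x, g (-x) = -g x) :
    ((c.kappaQ - κ' : ℚ) : ℝ) * weilNorm2Sq g ≤ weilTwoPrimeQuadratic g := by
  have _ := hκ'le
  obtain ⟨-, hbpos, hba, -, -, -, -, hN, -⟩ := WeilCert23.scalars_spec hsc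
  have hb0' : (0 : ℝ) < c.b := by exact_mod_cast hbpos
  have hba' : ((c.b : ℚ) : ℝ) ≤ (c.base.a0 : ℝ) := by exact_mod_cast hba
  have ha : (0 : ℝ) < (c.base.a0 : ℝ) := by linarith
  have hsupp' : tsupport g ⊆ Icc (-(c.base.a0 : ℝ)) c.base.a0 :=
    hsupp.trans (Icc_subset_Icc (by linarith) hba')
  have step3 := WeilCert23.margin_step3 hcells hsc hnu hg hsupp
  have hbes := weilNorm2Sq_ge_bessel hg ha hsupp' (c.base.N + 1)
    (c.base.uVec (weilMoment c.base.a0 g))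
  have hcore := WeilCert.core_nonnegK_odd (nu := c.nuTab) (κ := κ') hN hblk
    (weilMoment c.base.a0 g) fun i ↦ weilMoment_even_of_odd hodd _ (even_two_mul i)
  have h4 := mul_le_mul_of_nonneg_left hbes (show (0 : ℝ) ≤ ((κ' : ℚ) : ℝ) by exact_mod_cast hκ'0)
  push_cast
  linarith

end Literature.NumberTheory.LFunctions
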